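import Literature.MathematicalPhysics.QuantumFieldTheory.Balaban1983to89.B15Prop1NearValueOfMinimiserFamily
import Literature.MathematicalPhysics.QuantumFieldTheory.Balaban1983to89.B15Prop1JointHolomorphyFromMinimiserFamilyB
import Literature.MathematicalPhysics.QuantumFieldTheory.Balaban1983to89.B15Prop1GradientFromNearValueB

/-!
# `Balaban1983to89.B15Prop1NearValueOfMinimiserFamilyB` — [Balaban1989LargeFieldI] (= [B15]) (1.74) p. 192, (1.77) and Prop. 1 p. 194; [Balaban1989LargeFieldII] (1.2)–(1.6) p. 357, (1.15) p. 359;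
# [Balaban1985Variational] (= [15]) (5) p. 278, Prop. 9 (190) p. 309; [Balaban1988Convergent] (= [III]) (2.12)–(2.13) pp. 256–257; [Balaban1984PropagatorsII] (= [II]) (2.3) p. 224:
# (J1ˢ) ⇐ (J0′) — THE JOINT HOLOMORPHIC EXTENSION OF THE NEAR VALUE OF (1.77) FROM A HOLOMORPHIC FAMILY OF (2.12) MINIMISERS **OVER A BOND-LEVEL DATUM** — the print-datum edition of the
# lane's `B15Prop1NearValueOfMinimiserFamily` (THEOREMS ONLY)

statement-level skeleton of published theorems with citation tags; proofs where landed; nothing here is a claim about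
the Yang–Mills mass gap

Cell `pub-ymgap` (HUMAN RULINGS D-0062 ∕ D-0149), lane `pub-ymgap-dag-n12-c` g35 (R134 seat (a), N12 = [B15], s1); `--kind proof --supports` K1⁹ `stmt-QuantumFields-27364`;
count-neutral.  THEOREMS ONLY (0 `def`, 0 `instance`, 0 `sorry`).  (E1) variant (iii-b), class (β) of the lane's census-by-declaration (bus [DAGN12C-G35], 2026-08-30): the six
datum-bearing declarations of the parent that N12's junction of record v14ᴸ (#10983) uses (`farValue_eq_of_isMinimizer`, `nearValue_eq_of_isMinimizer`,
`nearValue_bgKZstd_bgOfRecord_eq_of_isMinimizer`, `jointHolomorphic_nearValue_bgOfRecord_of_minimiserFamily`, `jointHolomorphic_nearValue_bgMSCoPOfRecord_of_minimiserFamily`,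
`wilsonAction4_eq_of_isMinimizer` = O's `wilsonAction4_eq_of_isMinimizerB`) over a bond datum.  The level-`0` clause `hbd0` of `B15Prop1GradientFromNearValueB` (print's datum pins a minimiser
only on the bonds with BOTH end-points off `Ω₁(Z)`; enough for the far field) is displayed, and discharged for print's [II] (2.3) family at `Z`'s maximal sequence in the `…_lamDatumP`
corollaries; the parent's `0 < k` binder is subsumed by the clause in the generic editions.

HONESTY GUARD (director-ym №338 (5)).  PURELY ADDITIVE: the (b)-keyed parent stays landed and true on its own text; proofs are the parent's verbatim over `IsMinimizerB.pinned₂`,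
`farValue_eq_of_pinned₂`, S2a's `isMinimizerB_UminOfRecordB ∕ bgOfRecordB_U`, F's `bgKZstdB_apply`, O's `wilsonAction4_eq_of_isMinimizerB`, and dag-n12-c's datum-free
`jointHolomorphic_nearAction_of_cfgFamily`, `sum_filter_one_sub_reTr_eq_wilsonLoc`, `eq115`.  No displayed premise of any consumer is deleted or weakened.

WHAT IS HERE.
* §1 `farValue_eq_of_isMinimizerB` · ★ `nearValue_eq_of_isMinimizerB` · `nearValue_bgKZstdB_bgOfRecordB_eq_of_isMinimizerB` (clause `hbd0` displayed).
* §2 ★★ `jointHolomorphic_nearValue_bgOfRecordB_of_minimiserFamily` · ★★ `jointHolomorphic_nearValue_bgMSCoPOfRecordB_of_minimiserFamily` (clause displayed) ·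
  `jointHolomorphic_nearValue_bgMSCoPOfRecordB_of_minimiserFamily_lamDatumP` (print's family, clause discharged: `2 ≤ ν.M₁`-style `1 ≤ M₁`, `0 < k′ ≤ m + K`, torus divisibility).

HONEST SCOPE.  Junction bookkeeping; (J0′) is a HYPOTHESIS; nothing of [15] Thm 1 ∕ Prop. 9 asserted; count-neutral; N12 NOT discharged; K0⁷ ∕ K1⁹ NOT closed; one finite 𝕋⁴ programme at
fixed ε — nothing continuum ∕ ℝ⁴ ∕ OS; the Yang–Mills mass gap (Clay) is NOT proved by any of this.

References: [B15] = [Balaban1989LargeFieldI] (1.74) p.192, (1.77) and Prop. 1 p.194; [Balaban1989LargeFieldII] (1.1) p.356, (1.2)–(1.6) p.357, (1.15) p.359; [15] = [Balaban1985Variational] (2),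
(5) p.278, Prop. 9 (190) p.309; [III] = [Balaban1988Convergent] (1.12) p.248, (2.12)–(2.13) pp.256–257, p.255; [II] = [Balaban1984PropagatorsII] (2.3) p.224.
-/

noncomputable section

open Set Metric Finset
namespace Literature.MathematicalPhysics.QuantumFieldTheory.Balaban1983to89.B15Prop1NearValueOfMinimiserFamily

open T4Continuum B15DeterminingSets B15DeterminingSetsB GaugeField B15Prop1Carrier B8Eq17ClassAkV1 BlockAveraging
open Literature.MathematicalPhysics.QuantumFieldTheory.BalabanImbrieJaffe1984to88.BIJ85Eq453GaugeField (qsstarGIter0)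
open B15Prop1JointHolomorphyFromBackground B15Prop1ValueOfAnyMinimiser B15Prop1JointHolomorphyFromMinimiserFamily
open B15Prop1GradientFromNearValue (IsMinimizerB.pinned₂ farValue_eq_of_pinned₂ mem_lamDatumP_maxDomT_zero_of_not_mem₂ plaqHol_congr_of_not_mem_plaqsOf₂ wilsonLoc_congr)
open B15Eq177ValueInvariance (wilsonAction4_eq_of_isMinimizerB)
open B14.Eq213DetSet B15Sect1Instances B16Sect1Backgrounds B16Sect1Wilson
open B14.Eq213MaximalDomains (side)
open B14.Eq22Determines (blockIter)
open B15Prop1AnalyticExtClause (cplxVec)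
open B15Prop1ChartCalculusSU2 (E3)
open B15Prop1ChartSU2 (su2Chart)
open T4CubeChartGnomonic (SU2)
open scoped BigOperators

/-! ## §1  Two minimisers of one bond-datum (2.12) problem have one near action -/

section NearValueB

open Classical

variable {P : Params} {G : Type*} [GaugeGroup G]

/-- Two minimal configurations of the (2.12) problem on the bonds `bd k {Ω_j(Z)}` with data `M˙(W)` have the same FAR action (any weight vanishing on the plaquettes meeting `Ω₁(Z)`): both are
pinned to `W` on every bond with both end-points outside `Ω₁(Z)` (clause `hbd0`; `IsMinimizerB.pinned₂`), and a plaquette without a corner in `Ω₁(Z)` reads only such bonds; twin of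
`farValue_eq_of_isMinimizer`. [cite: Balaban1988Convergent, (1.12) p.248, (2.12)–(2.13) pp.256–257; Balaban1989LargeFieldII, (1.15) p.359; Balaban1984PropagatorsII, (2.3) p.224] -/
theorem farValue_eq_of_isMinimizerB {av : ∀ j, Averaging P j G} {reg : Set (GaugeField P 0 G)} {M₁ : ℕ} {bd : ℕ → (ℕ → Set (Site P 0)) → BDetSet P}
    {Z : Set (Site P 0)} {k : ℕ} (hbd0 : ∀ b : PBond P 0, b.src ∉ maxDomT M₁ Z 1 → b.tgt ∉ maxDomT M₁ Z 1 → b ∈ bd k (maxDomT M₁ Z) 0)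
    {W U₁ U₂ : GaugeField P 0 G} (h₁ : IsMinimizerB av reg (bd k (maxDomT M₁ Z)) (avgFamily av W) U₁) (h₂ : IsMinimizerB av reg (bd k (maxDomT M₁ Z)) (avgFamily av W) U₂)
    (ζ : Plaq P 0 → ℝ) (hζ : ∀ p, ζ p ≠ 0 → p ∉ plaqsOf (maxDomT M₁ Z 1)) :
    wilsonLoc ζ U₁ = wilsonLoc ζ U₂ :=
  farValue_eq_of_pinned₂ (IsMinimizerB.pinned₂ hbd0 h₁) (IsMinimizerB.pinned₂ hbd0 h₂) ζ hζ

/-- ★ **TWO MINIMISERS OF ONE BOND-DATUM (2.12) PROBLEM HAVE ONE NEAR ACTION**: `Σ_{p ∈ plaqsOf Ω₁(Z)} (1 − Re tr U₁(∂p)) = Σ_{p ∈ plaqsOf Ω₁(Z)} (1 − Re tr U₂(∂p))` — total actions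
agree (`wilsonAction4_eq_of_isMinimizerB`), far actions agree, and `A = A(ζ₀) + A(1 − ζ₀)` (`eq115`); twin of `nearValue_eq_of_isMinimizer`.
[cite: Balaban1989LargeFieldII, (1.15) p.359, (1.2)–(1.6) p.357; Balaban1988Convergent, (2.12)–(2.13) pp.256–257; Balaban1989LargeFieldI, (1.74) p.192; Balaban1984PropagatorsII, (2.3) p.224] -/
theorem nearValue_eq_of_isMinimizerB {av : ∀ j, Averaging P j G} {reg : Set (GaugeField P 0 G)} {M₁ : ℕ} {bd : ℕ → (ℕ → Set (Site P 0)) → BDetSet P}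
    {Z : Set (Site P 0)} {k : ℕ} (hbd0 : ∀ b : PBond P 0, b.src ∉ maxDomT M₁ Z 1 → b.tgt ∉ maxDomT M₁ Z 1 → b ∈ bd k (maxDomT M₁ Z) 0)
    {W U₁ U₂ : GaugeField P 0 G} (h₁ : IsMinimizerB av reg (bd k (maxDomT M₁ Z)) (avgFamily av W) U₁) (h₂ : IsMinimizerB av reg (bd k (maxDomT M₁ Z)) (avgFamily av W) U₂) :
    wilsonLoc ((plaqsOf (maxDomT M₁ Z 1)).indicator fun _ => (1 : ℝ)) U₁ = wilsonLoc ((plaqsOf (maxDomT M₁ Z 1)).indicator fun _ => (1 : ℝ)) U₂ := by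
  have hζfar : ∀ p : Plaq P 0, 1 - (plaqsOf (maxDomT M₁ Z 1)).indicator (fun _ => (1 : ℝ)) p ≠ 0 → p ∉ plaqsOf (maxDomT M₁ Z 1) := by
    intro p hp hmem
    apply hp
    simp only [Set.indicator_of_mem hmem, sub_self]
  have htot := wilsonAction4_eq_of_isMinimizerB av h₁ h₂
  rw [eq115 ((plaqsOf (maxDomT M₁ Z 1)).indicator fun _ => (1 : ℝ)) U₁, eq115 ((plaqsOf (maxDomT M₁ Z 1)).indicator fun _ => (1 : ℝ)) U₂,
    farValue_eq_of_isMinimizerB hbd0 h₁ h₂ _ hζfar] at htot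
  linarith

/-- **THE NEAR VALUE OF THE SELECTED BOND-DATUM MINIMISER OF RECORD IS THAT OF ANY MINIMISER**: at the totalised bond-level map `Node00.bgOfRecordB av reg`, if `U′` is a minimal configuration of the
problem for `M˙(Q_k^{s*}V)` on the bonds `bd k {Ω_j(Z)}` (clause `hbd0`), then the near action of `U_{k,Z}(V) = bgKZstdB (bgOfRecordB av reg) M₁ bd Z k V` (the selected minimiser `UminOfRecordB`,
itself a minimiser since the problem is solvable) equals that of `U′`; twin of `nearValue_bgKZstd_bgOfRecord_eq_of_isMinimizer`.
[cite: Balaban1988Convergent, (2.12)–(2.13) pp.256–257; Balaban1989LargeFieldI, (1.74) p.192; Balaban1989LargeFieldII, (1.15) p.359; Balaban1984PropagatorsII, (2.3) p.224] -/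
theorem nearValue_bgKZstdB_bgOfRecordB_eq_of_isMinimizerB (av : ∀ j, Averaging P j SU2) (reg : Set (GaugeField P 0 SU2)) {M₁ : ℕ}
    {bd : ℕ → (ℕ → Set (Site P 0)) → BDetSet P} {Z : Set (Site P 0)} {k : ℕ}
    (hbd0 : ∀ b : PBond P 0, b.src ∉ maxDomT M₁ Z 1 → b.tgt ∉ maxDomT M₁ Z 1 → b ∈ bd k (maxDomT M₁ Z) 0)
    {V : GaugeField P k SU2} {U' : GaugeField P 0 SU2} (hU' : IsMinimizerB av reg (bd k (maxDomT M₁ Z)) (avgFamily av (qsstarGIter0 k V)) U') :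
    wilsonLoc ((plaqsOf (maxDomT M₁ Z 1)).indicator fun _ => (1 : ℝ)) (bgKZstdB (Node00.bgOfRecordB av reg) M₁ bd Z k V) =
      wilsonLoc ((plaqsOf (maxDomT M₁ Z 1)).indicator fun _ => (1 : ℝ)) U' := by
  have hU : bgKZstdB (Node00.bgOfRecordB av reg) M₁ bd Z k V = Node00.UminOfRecordB av reg (bd k (maxDomT M₁ Z)) (avgFamily av (qsstarGIter0 k V)) := by
    rw [bgKZstdB_apply, Node00.bgOfRecordB_U]
  rw [hU]
  exact nearValue_eq_of_isMinimizerB hbd0 (Node00.isMinimizerB_UminOfRecordB av reg ⟨U', hU'⟩) hU'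

end NearValueB

/-! ## §2  (J1ˢ) ⇐ (J0′) over a bond datum: the joint holomorphic extension of the NEAR value from a holomorphic family of minimisers, with the near count -/

section OfRecordB

open Classical

variable {P : Params}

/-- ★★ **(J1ˢ) FROM A HOLOMORPHIC FAMILY OF MINIMISERS, at the totalised BOND-LEVEL (2.12) solution map** `Node00.bgOfRecordB av reg` (any class `reg`), over a bond-datum family `bd` with the
level-`0` clause `hbd0`: under (J0′) — ONE family `Ũ` of bond matrices on the sup-ball of radius `R`, ℂ-differentiable entries bounded by `𝓐₀ ≥ 0`, which at every REAL point `(p, B′)` IS some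
`SU(2)` MINIMAL CONFIGURATION of the (2.12) problem for the datum `M˙(Q_k^{s*}(exp(iB′)·ext(exp(ip)V_k)))` ON THE BONDS `bd k {Ω_j(Z)}` — the NEAR value `(p, B′) ↦ Σ_{q ∈ plaqsOf Ω₁(Z)} (1 −
Re tr U_{k,Z}(·)(∂q))` is the real trace of ONE ℂ-differentiable `𝒢ˢ` on that ball with `‖𝒢ˢ‖ ≤ #plaqsOf(Ω₁(Z))·(1 + 8𝓐₀⁴)`; twin of `jointHolomorphic_nearValue_bgOfRecord_of_minimiserFamily`.
[cite: Balaban1989LargeFieldI, (1.74) p.192, (1.77) and Prop. 1 p.194; Balaban1989LargeFieldII, (1.2)–(1.6) p.357, p.359; Balaban1985Variational, Prop. 9 (190) p.309; Balaban1988Convergent, (2.12) p.256; Balaban1984PropagatorsII, (2.3) p.224] -/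
theorem jointHolomorphic_nearValue_bgOfRecordB_of_minimiserFamily (av : ∀ j, Averaging P j SU2) (reg : Set (GaugeField P 0 SU2))
    (M₁ : ℕ) (bd : ℕ → (ℕ → Set (Site P 0)) → BDetSet P) (Z : Set (Site P 0)) (k : ℕ)
    (hbd0 : ∀ b : PBond P 0, b.src ∉ maxDomT M₁ Z 1 → b.tgt ∉ maxDomT M₁ Z 1 → b ∈ bd k (maxDomT M₁ Z) 0)
    (ext : GaugeField P k SU2 → GaugeField P k SU2) (Vk : GaugeField P k SU2) {R 𝓐₀ : ℝ} (h𝓐₀ : 0 ≤ 𝓐₀)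
    (hMin : ∃ Ũ : VecField P k (EuclideanSpace ℂ (Fin 3)) × VecField P k (EuclideanSpace ℂ (Fin 3)) → PBond P 0 → Matrix (Fin 2) (Fin 2) ℂ,
      (∀ b a c, DifferentiableOn ℂ (fun z => Ũ z b a c) (ball 0 R)) ∧
      (∀ z ∈ ball (0 : VecField P k (EuclideanSpace ℂ (Fin 3)) × VecField P k (EuclideanSpace ℂ (Fin 3))) R, ∀ b a c, ‖Ũ z b a c‖ ≤ 𝓐₀) ∧
      ∀ p B' : VecField P k E3, ‖p‖ < R → ‖B'‖ < R → ∃ U' : GaugeField P 0 SU2,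
        (∀ b, Ũ (cplxVec p, cplxVec B') b = ((U' b : SU2) : Matrix (Fin 2) (Fin 2) ℂ)) ∧
          IsMinimizerB av reg (bd k (maxDomT M₁ Z)) (avgFamily av (qsstarGIter0 k (expMul su2Chart B' (ext (expMul su2Chart p Vk))))) U') :
    ∃ 𝒢S : VecField P k (EuclideanSpace ℂ (Fin 3)) × VecField P k (EuclideanSpace ℂ (Fin 3)) → ℂ,
      DifferentiableOn ℂ 𝒢S (ball 0 R) ∧
      (∀ z ∈ ball (0 : VecField P k (EuclideanSpace ℂ (Fin 3)) × VecField P k (EuclideanSpace ℂ (Fin 3))) R,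
        ‖𝒢S z‖ ≤ (Nat.card {q : Plaq P 0 // q ∈ plaqsOf (maxDomT M₁ Z 1)} : ℝ) * (1 + 8 * 𝓐₀ ^ 4)) ∧
      ∀ p B' : VecField P k E3, ‖p‖ < R → ‖B'‖ < R →
        𝒢S (cplxVec p, cplxVec B') =
          ((wilsonLoc ((plaqsOf (maxDomT M₁ Z 1)).indicator fun _ => (1 : ℝ))
            (bgKZstdB (Node00.bgOfRecordB av reg) M₁ bd Z k (expMul su2Chart B' (ext (expMul su2Chart p Vk)))) : ℝ) : ℂ) := by
  classical
  obtain ⟨Ũ, hdiff, hbd, hreal⟩ := hMin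
  obtain ⟨𝒢, hd, hb, hr⟩ := jointHolomorphic_nearAction_of_cfgFamily (Finset.univ.filter fun q : Plaq P 0 => q ∈ plaqsOf (maxDomT M₁ Z 1)) h𝓐₀ hdiff hbd
  have hcard : ((Finset.univ.filter fun q : Plaq P 0 => q ∈ plaqsOf (maxDomT M₁ Z 1)).card : ℝ) =
      (Nat.card {q : Plaq P 0 // q ∈ plaqsOf (maxDomT M₁ Z 1)} : ℝ) := by
    rw [Nat.card_eq_fintype_card, Fintype.card_subtype]
  refine ⟨𝒢, hd, fun z hz => hcard ▸ hb z hz, fun p B' hp hB' => ?_⟩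
  obtain ⟨U', hU', hmin⟩ := hreal p B' hp hB'
  rw [hr p B' hp hB' U' hU', nearValue_bgKZstdB_bgOfRecordB_eq_of_isMinimizerB av reg hbd0 hmin, ← sum_filter_one_sub_reTr_eq_wilsonLoc]
  push_cast
  rfl

end OfRecordB

section RecordB

open Classical

variable {F : T4Family}

/-- ★★ **(J1ˢ) FROM A HOLOMORPHIC FAMILY OF MINIMISERS, at the BOND-LEVEL (2.12) datum of record** `Node00.bgMSCoPOfRecordB F 2 ν K k Ω` (S2b; the class `regMSCoPOfRecord F 2 ν K k Ω` = [15] (2),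
print's, unchanged) over a bond-datum family `bd` with the level-`0` clause `hbd0`: (J0′) ⇒ (J1ˢ) for the near value of `bgKZstdB (bgMSCoPOfRecordB …) M₁ bd Z k′` with `𝓐S =
#plaqsOf(Ω₁(Z))·(1 + 8𝓐₀⁴)`; twin of `jointHolomorphic_nearValue_bgMSCoPOfRecord_of_minimiserFamily`. [cite: Balaban1989LargeFieldI, (1.74) p.192, (1.77) and Prop. 1 p.194; Balaban1989LargeFieldII, (1.2)–(1.6) p.357, p.359; Balaban1985Variational, (2) p.278, Prop. 9 (190) p.309; Balaban1988Convergent, (2.12) p.256, p.255; Balaban1984PropagatorsII, (2.3) p.224] -/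
theorem jointHolomorphic_nearValue_bgMSCoPOfRecordB_of_minimiserFamily (ν : Node00.Stage7Numerics) (K k : ℕ) (Ω : ℕ → Set (Site (F.P K) 0))
    (M₁ : ℕ) (bd : ℕ → (ℕ → Set (Site (F.P K) 0)) → BDetSet (F.P K)) (Z : Set (Site (F.P K) 0)) (k' : ℕ)
    (hbd0 : ∀ b : PBond (F.P K) 0, b.src ∉ maxDomT M₁ Z 1 → b.tgt ∉ maxDomT M₁ Z 1 → b ∈ bd k' (maxDomT M₁ Z) 0)
    (ext : GaugeField (F.P K) k' SU2 → GaugeField (F.P K) k' SU2)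
    (Vk : GaugeField (F.P K) k' SU2) {R 𝓐₀ : ℝ} (h𝓐₀ : 0 ≤ 𝓐₀)
    (hMin : ∃ Ũ : VecField (F.P K) k' (EuclideanSpace ℂ (Fin 3)) × VecField (F.P K) k' (EuclideanSpace ℂ (Fin 3)) →
        PBond (F.P K) 0 → Matrix (Fin 2) (Fin 2) ℂ,
      (∀ b a c, DifferentiableOn ℂ (fun z => Ũ z b a c) (ball 0 R)) ∧
      (∀ z ∈ ball (0 : VecField (F.P K) k' (EuclideanSpace ℂ (Fin 3)) × VecField (F.P K) k' (EuclideanSpace ℂ (Fin 3))) R,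
        ∀ b a c, ‖Ũ z b a c‖ ≤ 𝓐₀) ∧
      ∀ p B' : VecField (F.P K) k' E3, ‖p‖ < R → ‖B'‖ < R → ∃ U' : GaugeField (F.P K) 0 SU2,
        (∀ b, Ũ (cplxVec p, cplxVec B') b = ((U' b : SU2) : Matrix (Fin 2) (Fin 2) ℂ)) ∧
          IsMinimizerB (Node00.avOfRecord F 2 K) (Node00.regMSCoPOfRecord F 2 ν K k Ω) (bd k' (maxDomT M₁ Z))
            (avgFamily (Node00.avOfRecord F 2 K) (qsstarGIter0 k' (expMul su2Chart B' (ext (expMul su2Chart p Vk))))) U') :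
    ∃ 𝒢S : VecField (F.P K) k' (EuclideanSpace ℂ (Fin 3)) × VecField (F.P K) k' (EuclideanSpace ℂ (Fin 3)) → ℂ,
      DifferentiableOn ℂ 𝒢S (ball 0 R) ∧
      (∀ z ∈ ball (0 : VecField (F.P K) k' (EuclideanSpace ℂ (Fin 3)) × VecField (F.P K) k' (EuclideanSpace ℂ (Fin 3))) R,
        ‖𝒢S z‖ ≤ (Nat.card {q : Plaq (F.P K) 0 // q ∈ plaqsOf (maxDomT M₁ Z 1)} : ℝ) * (1 + 8 * 𝓐₀ ^ 4)) ∧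
      ∀ p B' : VecField (F.P K) k' E3, ‖p‖ < R → ‖B'‖ < R →
        𝒢S (cplxVec p, cplxVec B') =
          ((wilsonLoc ((plaqsOf (maxDomT M₁ Z 1)).indicator fun _ => (1 : ℝ))
            (bgKZstdB (Node00.bgMSCoPOfRecordB F 2 ν K k Ω) M₁ bd Z k' (expMul su2Chart B' (ext (expMul su2Chart p Vk)))) : ℝ) : ℂ) :=
  jointHolomorphic_nearValue_bgOfRecordB_of_minimiserFamily (Node00.avOfRecord F 2 K) (Node00.regMSCoPOfRecord F 2 ν K k Ω) M₁ bd Z k' hbd0 ext Vk h𝓐₀ hMin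

/-- The same at PRINT'S [II] (2.3) FAMILY `lamDatumP`, the level-`0` clause discharged at `Z`'s maximal sequence (`1 ≤ M₁`, `0 < k′ ≤ m + K`, `side L M₁ k′ ∣ sitesPerDir 0`:
`mem_lamDatumP_maxDomT_zero_of_not_mem₂`) — the edition the re-attached N12 road consumes. [cite: Balaban1989LargeFieldI, (1.74) p.192, (1.77) and Prop. 1 p.194; Balaban1984PropagatorsII, (2.3) p.224; Balaban1988Convergent, (2.13) pp.256–257] -/
theorem jointHolomorphic_nearValue_bgMSCoPOfRecordB_of_minimiserFamily_lamDatumP (ν : Node00.Stage7Numerics) (K k : ℕ) (Ω : ℕ → Set (Site (F.P K) 0))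
    {M₁ : ℕ} (hM : 1 ≤ M₁) (Z : Set (Site (F.P K) 0)) {k' : ℕ} (hk0 : 0 < k') (hk' : k' ≤ (F.P K).m + (F.P K).K)
    (hdiv : side (F.P K).L M₁ k' ∣ (F.P K).sitesPerDir 0)
    (ext : GaugeField (F.P K) k' SU2 → GaugeField (F.P K) k' SU2)
    (Vk : GaugeField (F.P K) k' SU2) {R 𝓐₀ : ℝ} (h𝓐₀ : 0 ≤ 𝓐₀)
    (hMin : ∃ Ũ : VecField (F.P K) k' (EuclideanSpace ℂ (Fin 3)) × VecField (F.P K) k' (EuclideanSpace ℂ (Fin 3)) →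
        PBond (F.P K) 0 → Matrix (Fin 2) (Fin 2) ℂ,
      (∀ b a c, DifferentiableOn ℂ (fun z => Ũ z b a c) (ball 0 R)) ∧
      (∀ z ∈ ball (0 : VecField (F.P K) k' (EuclideanSpace ℂ (Fin 3)) × VecField (F.P K) k' (EuclideanSpace ℂ (Fin 3))) R,
        ∀ b a c, ‖Ũ z b a c‖ ≤ 𝓐₀) ∧
      ∀ p B' : VecField (F.P K) k' E3, ‖p‖ < R → ‖B'‖ < R → ∃ U' : GaugeField (F.P K) 0 SU2,
        (∀ b, Ũ (cplxVec p, cplxVec B') b = ((U' b : SU2) : Matrix (Fin 2) (Fin 2) ℂ)) ∧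
          IsMinimizerB (Node00.avOfRecord F 2 K) (Node00.regMSCoPOfRecord F 2 ν K k Ω) (lamDatumP k' (maxDomT M₁ Z))
            (avgFamily (Node00.avOfRecord F 2 K) (qsstarGIter0 k' (expMul su2Chart B' (ext (expMul su2Chart p Vk))))) U') :
    ∃ 𝒢S : VecField (F.P K) k' (EuclideanSpace ℂ (Fin 3)) × VecField (F.P K) k' (EuclideanSpace ℂ (Fin 3)) → ℂ,
      DifferentiableOn ℂ 𝒢S (ball 0 R) ∧
      (∀ z ∈ ball (0 : VecField (F.P K) k' (EuclideanSpace ℂ (Fin 3)) × VecField (F.P K) k' (EuclideanSpace ℂ (Fin 3))) R,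
        ‖𝒢S z‖ ≤ (Nat.card {q : Plaq (F.P K) 0 // q ∈ plaqsOf (maxDomT M₁ Z 1)} : ℝ) * (1 + 8 * 𝓐₀ ^ 4)) ∧
      ∀ p B' : VecField (F.P K) k' E3, ‖p‖ < R → ‖B'‖ < R →
        𝒢S (cplxVec p, cplxVec B') =
          ((wilsonLoc ((plaqsOf (maxDomT M₁ Z 1)).indicator fun _ => (1 : ℝ))
            (bgKZstdB (Node00.bgMSCoPOfRecordB F 2 ν K k Ω) M₁ lamDatumP Z k' (expMul su2Chart B' (ext (expMul su2Chart p Vk)))) : ℝ) : ℂ) :=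
  jointHolomorphic_nearValue_bgMSCoPOfRecordB_of_minimiserFamily ν K k Ω M₁ lamDatumP Z k'
    (fun b hs ht => mem_lamDatumP_maxDomT_zero_of_not_mem₂ hM hk0 hk' hdiv b hs ht) ext Vk h𝓐₀ hMin

end RecordB

end Literature.MathematicalPhysics.QuantumFieldTheory.Balaban1983to89.B15Prop1NearValueOfMinimiserFamily

end
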